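import Literature.NumberTheory.Automorphic.ResiduallyTrivialFixedCosetCount            -- ★ ROW-0: `rank_redMat_sub_one_eq_zero_iff_forall_valuation_le` (any uniformising element)
import Literature.NumberTheory.Automorphic.UnitaryGroupReductionSurjectiveOfTwo         -- ★ (m1) §1 p846840 (this seat): `unitary_residueHom_surjective_of_isUnit_two` (Hensel at `v ∤ 2`, ramified included)
import Literature.NumberTheory.Automorphic.UnitaryGroupIntegralPointsReductionRamified -- ★ D-T1u-ram: `residueHom_galAdicCompletionMap_eq_id_of_ramified` (`σ̄_w = id`)
import Literature.NumberTheory.Automorphic.UnitaryGroupIntegralPointsReductionInert    -- ★ §4 transport (place-free): `exists_residueField_ringHom_galAdicCompletionMap`, `mem_integer_galAdicCompletionMap`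
import Literature.NumberTheory.Automorphic.LocalUnitaryIntegralLevel                   -- ★ `cmLocalIntegralLevel`, `mem_localIntegralLevel_iff_of_smul_eq`
import Literature.NumberTheory.Automorphic.ValuedFieldValuativeRelBridge               -- ★ `isUniformizingElement_of_v_eq`, `v_le_iff_valuation_le`
import Literature.NumberTheory.Automorphic.UnitaryGroupInertPlaceHyperbolicBasis       -- ★ `placeForm_hermitian_of_smul_eq`, `galAdicCompletionMap_galAdicCompletionMap_of_smul_eq` (place-free)
import Literature.NumberTheory.Automorphic.UnitaryGroupFormTransport                   -- ★ `formCongr`, `conj_mem_unitaryGroupOfForm`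
import Literature.NumberTheory.Rogawski1990.U3SupercuspidalJacquetVanishing           -- ★ `coe_localNonsplitEquiv_apply` (rfl)
import Literature.GroupTheory.SpecificGroups.OrthogonalThreeUnipotentJordanClasses     -- ★ E-fin-ram (F0P3-p03 (g14), p846826): `exists_conj_eq_of_rank_sub_one_eq_of_orthogonal`, `mem_unitaryGroupOfForm_smul_iff`
import HarnessLib

/-!
# ORGAN (U)-ram «STRATA CONSTANCY AT A TAME-RAMIFIED PLACE, O₃-TYPE VERTEX»: a `K`-class piece of `w`-level `1` on `U(H′)(L⁺_v)` is CONSTANT on each residually-unipotent Jordan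
# stratum `rank(red k_w − 1) = r` of `K` — because `K ↠ O(J̄)(𝔽_{q_v})` (Hensel at `v ∤ 2`) and the unipotent classes of `O₃(𝔽_q)` are classified by the rank (★ p846826)

Topic `NumberTheory/Rogawski1990`; namespace `Literature.NumberTheory.Rogawski1990`.  THEOREMS ONLY (no definition, no instance, no notation, no named fact, no `sorry`).
Cell `pub/hodgecm-mathlib` (D-0151), crux H413 = `stmt-HodgeConjecture-24833`; road «S3-ram» (LEAD F0P3a-plan (g12) T11-41∕T11-48; wave owner∕desk F0P3a-p06 (g15), table `S3RAM-ORGANS.md`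
row (m1) «(U)-ram»; END F0P3a-p03 (g16) fold v2 `LocalTransferAtOneTameRamified.fold.v2` daaa807d — its `stub_rowsRam` populations step); hand F0P3a-p05 (g15), 2026-09-01.
The RAMIFIED TWIN of ★ p846483 `LevelOnePieceStrataConstancy` (organ (U), F0P3a-p06 (g14)) — same proof skeleton, three inputs swapped:
(1) `hv` (unramified) ↦ `he` (ramified); the conjugation reduces to the IDENTITY on `𝓀_w = 𝓀_v` (★ `residueHom_galAdicCompletionMap_eq_id_of_ramified`), so the residue group is the
    finite ORTHOGONAL group `O(J̄)(𝔽_{q_v})`; Hensel surjectivity `K ↠ O(J̄)(𝔽_q)` is ★ `unitary_residueHom_surjective_of_isUnit_two` (`2 ∈ 𝒪_wˣ`; no `σ`-fixed uniformiser exists here);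
(2) the finite half is ★ `exists_conj_eq_of_rank_sub_one_eq_of_orthogonal` for Mok's antidiagonal `J₀` — reached from `J̄` through the SPAN-0-ram INTEGRAL ANTIDIAGONAL FRAME
    `H′_w = (−det H′_w) • ᵗ(σA) J₀ A`, `A ∈ GL₃(𝒪_w)` (fold v2 binders `(A hA hframe)`, ★ p846344): residually `J̄ = c̄ • Āᵀ J₀ Ā`, `c̄ ≠ 0`, and `x ↦ Ā x Ā⁻¹` carries `O(J̄)` onto `O(J₀)`
    preserving `rank(x − 1)` — THIS IS THE O₃-TYPE (standard self-dual) VERTEX; at the other special vertex of the ramified building (`Sp₂ × O₁` type, F0P3-p03 (g14) (b) «E-fin-ram′»)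
    rank-strata constancy FAILS and this file says nothing there;
(3) the LEVEL is ONE `w`-LEVEL: left-invariance under `{u ∈ K : u_w ≡ 1 (ϖ_w)}` with the fold's block uniformiser `ϖ = ϖ_w` (`|ϖ_w| = exp(−1)`; binder `(ϖ hϖ)`; `hσϖ` is not needed and not
    taken), NOT `ϖ_v = ϖ_w²`; the ROW-0 bridge ★ `rank_redMat_sub_one_eq_zero_iff_forall_valuation_le` takes any uniformising element.
* `apply_eq_apply_of_rank_redMat_sub_one_eq_ramified` — `g k = g k′` for residually unipotent `k, k′ ∈ K` of equal Jordan rank;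
* **`strataConstancy_of_levelOne_ramified`** — `∃ c : ℕ → ℂ, ∀ k ∈ K, (red k_w − 1)³ = 0 → g k = c (rank (red k_w − 1))` (ranks `∈ {0, 2}` in `O₃`, ★ `rank_sub_one_ne_one_of_mem_orthogonal`; `c 1` is junk).
HONEST LABEL: HC_CM is proved only modulo the printed citations (2 remaining named inputs hLiu418 24832, h413 24833) until rung 0 closes; unconditional local algebra, asserts nothing printed
about the transfer; Literature seeding of the «S3-ram» wave (LEAD T11-41: no books consequence).

## References
* [Rogawski1990] J. D. Rogawski, *Automorphic Representations of Unitary Groups in Three Variables* (1990): §4.9 p. 54, §3.9 p. 32 and Prop. 3.9.1, §1.10 p. 9.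
* [PlatonovRapinchuk1994] V. Platonov, A. Rapinchuk, *Algebraic Groups and Number Theory* (1994): §3.3 (reduction `G_𝒪 → G_𝓀`, Hensel), §5.1.
-/

set_option autoImplicit false

noncomputable section

open NumberField IsDedekindDomain Matrix ValuativeRel
open Literature.NumberTheory.Automorphic Literature.NumberTheory.GaloisRepresentations Literature.NumberTheory.Automorphic.UnitaryGroup
open Literature.NumberTheory.Automorphic.IntegralReduction Literature.GroupTheory.SpecificGroups
open scoped Matrix MatrixGroups ValuativeRel

namespace Literature.NumberTheory.Rogawski1990

/-! ## §A Transport of the finite half through a residual frame `J̄ = c̄ • Āᵀ J₀ Ā` (any field with `2 ≠ 0`) -/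

section Frame

variable {K : Type*} [Field K]

/-- `formCongr id T⁻¹ (formCongr id T H) = H`. [folklore] -/
private theorem formCongr_id_inv_formCongr_id (T : GL (Fin 3) K) (H : Matrix (Fin 3) (Fin 3) K) :
    formCongr (RingHom.id K) T⁻¹ (formCongr (RingHom.id K) T H) = H := by
  have hm : ∀ M : Matrix (Fin 3) (Fin 3) K, M.map ⇑(RingHom.id K) = M := fun M => by ext; rfl
  simp only [formCongr, hm]
  have h2 : (T : Matrix (Fin 3) (Fin 3) K) * ((T⁻¹ : GL (Fin 3) K) : Matrix (Fin 3) (Fin 3) K) = 1 := by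
    rw [← Units.val_mul, mul_inv_cancel, Units.val_one]
  calc ((T⁻¹ : GL (Fin 3) K) : Matrix (Fin 3) (Fin 3) K)ᵀ * (((T : Matrix (Fin 3) (Fin 3) K))ᵀ * H * (T : Matrix (Fin 3) (Fin 3) K)) * ((T⁻¹ : GL (Fin 3) K) : Matrix (Fin 3) (Fin 3) K)
      = ((T⁻¹ : GL (Fin 3) K) : Matrix (Fin 3) (Fin 3) K)ᵀ * ((T : Matrix (Fin 3) (Fin 3) K))ᵀ * H * ((T : Matrix (Fin 3) (Fin 3) K) * ((T⁻¹ : GL (Fin 3) K) : Matrix (Fin 3) (Fin 3) K)) := by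
        simp only [Matrix.mul_assoc]
    _ = ((T : Matrix (Fin 3) (Fin 3) K) * ((T⁻¹ : GL (Fin 3) K) : Matrix (Fin 3) (Fin 3) K))ᵀ * H * ((T : Matrix (Fin 3) (Fin 3) K) * ((T⁻¹ : GL (Fin 3) K) : Matrix (Fin 3) (Fin 3) K)) := by
        rw [Matrix.transpose_mul]
    _ = H := by rw [h2, Matrix.transpose_one, Matrix.one_mul, Matrix.mul_one]

/-- **THE FINITE HALF THROUGH A FRAME**: over a field with `2 ≠ 0`, if `J̄ = c • Āᵀ J₀ Ā` (`c ≠ 0`, `J₀` Mok's antidiagonal form, `Ā ∈ GL₃`), two unipotents of `O(J̄)` with the same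
`rank(· − 1)` are conjugate IN `O(J̄)` (stated for any `σ'` that IS the identity pointwise, so that a residue action `σk` proved trivial plugs in without rewriting) — ★ `exists_conj_eq_of_rank_sub_one_eq_of_orthogonal` transported by `x ↦ Ā x Ā⁻¹` (★ `conj_mem_unitaryGroupOfForm`; the scalar by
★ `mem_unitaryGroupOfForm_smul_iff`). [cite: Rogawski1990, §3.9 p. 32, Prop. 3.9.1] -/
theorem exists_conj_eq_of_rank_sub_one_eq_of_residueFrame (h2 : (2 : K) ≠ 0) {σ' : K →+* K} (hσ' : ∀ x, σ' x = x) (Ab : GL (Fin 3) K) {c : K} (hc : c ≠ 0)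
    {Jb : Matrix (Fin 3) (Fin 3) K} (hJb : Jb = c • formCongr σ' Ab ((StdForm.antidiagonal 3).over K)) {u u' : GL (Fin 3) K}
    (hu : u ∈ unitaryGroupOfForm σ' Jb) (hu' : u' ∈ unitaryGroupOfForm σ' Jb)
    (hnil : IsNilpotent ((u : Matrix (Fin 3) (Fin 3) K) - 1)) (hnil' : IsNilpotent ((u' : Matrix (Fin 3) (Fin 3) K) - 1))
    (hrank : ((u : Matrix (Fin 3) (Fin 3) K) - 1).rank = ((u' : Matrix (Fin 3) (Fin 3) K) - 1).rank) :
    ∃ y : GL (Fin 3) K, y ∈ unitaryGroupOfForm σ' Jb ∧ y * u * y⁻¹ = u' := by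
  obtain rfl : σ' = RingHom.id K := RingHom.ext hσ'
  subst hJb
  -- transport `O(J̄) → O(J₀)` by `x ↦ Ā x Ā⁻¹` and back
  have hto : ∀ {x : GL (Fin 3) K}, x ∈ unitaryGroupOfForm (RingHom.id K) (c • formCongr (RingHom.id K) Ab ((StdForm.antidiagonal 3).over K)) →
      Ab * x * Ab⁻¹ ∈ unitaryGroupOfForm (RingHom.id K) ((StdForm.antidiagonal 3).over K) := fun {x} hx =>
    conj_mem_unitaryGroupOfForm (RingHom.id K) Ab _ ((mem_unitaryGroupOfForm_smul_iff (RingHom.id K) _ hc x).1 hx)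
  have hback : ∀ {y : GL (Fin 3) K}, y ∈ unitaryGroupOfForm (RingHom.id K) ((StdForm.antidiagonal 3).over K) →
      Ab⁻¹ * y * Ab ∈ unitaryGroupOfForm (RingHom.id K) (c • formCongr (RingHom.id K) Ab ((StdForm.antidiagonal 3).over K)) := fun {y} hy => by
    have hy' : y ∈ unitaryGroupOfForm (RingHom.id K) (formCongr (RingHom.id K) Ab⁻¹ (formCongr (RingHom.id K) Ab ((StdForm.antidiagonal 3).over K))) := by
      rwa [formCongr_id_inv_formCongr_id]
    have h := conj_mem_unitaryGroupOfForm (RingHom.id K) Ab⁻¹ _ hy'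
    rw [inv_inv] at h
    exact (mem_unitaryGroupOfForm_smul_iff (RingHom.id K) _ hc _).2 h
  -- `Ā x Ā⁻¹ − 1 = Ā (x − 1) Ā⁻¹`: nilpotency and rank are preserved
  have hconjsub : ∀ x : GL (Fin 3) K, ((Ab * x * Ab⁻¹ : GL (Fin 3) K) : Matrix (Fin 3) (Fin 3) K) - 1 =
      (Ab : Matrix (Fin 3) (Fin 3) K) * ((x : Matrix (Fin 3) (Fin 3) K) - 1) * ((Ab⁻¹ : GL (Fin 3) K) : Matrix (Fin 3) (Fin 3) K) := fun x => by
    rw [Matrix.mul_sub, Matrix.sub_mul, Matrix.mul_one, Units.val_mul, Units.val_mul, Units.mul_inv]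
  have hnilc : ∀ {x : GL (Fin 3) K}, IsNilpotent ((x : Matrix (Fin 3) (Fin 3) K) - 1) → IsNilpotent (((Ab * x * Ab⁻¹ : GL (Fin 3) K) : Matrix (Fin 3) (Fin 3) K) - 1) :=
    fun {x} ⟨m, hm⟩ => ⟨m, by rw [hconjsub, Units.conj_pow, hm, Matrix.mul_zero, Matrix.zero_mul]⟩
  have hrankc : ∀ x : GL (Fin 3) K, ((((Ab * x * Ab⁻¹ : GL (Fin 3) K) : Matrix (Fin 3) (Fin 3) K) - 1)).rank = ((x : Matrix (Fin 3) (Fin 3) K) - 1).rank := fun x => by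
    rw [hconjsub, Matrix.rank_mul_eq_left_of_isUnit_det _ _ (Matrix.isUnits_det_units Ab⁻¹),
      Matrix.rank_mul_eq_right_of_isUnit_det _ _ (Matrix.isUnits_det_units Ab)]
  obtain ⟨gb, hgb, hconjb⟩ := exists_conj_eq_of_rank_sub_one_eq_of_orthogonal h2 (hto hu) (hto hu') (hnilc hnil) (hnilc hnil')
    (by rw [hrankc, hrankc]; exact hrank)
  refine ⟨Ab⁻¹ * gb * Ab, hback hgb, ?_⟩
  calc Ab⁻¹ * gb * Ab * u * (Ab⁻¹ * gb * Ab)⁻¹ = Ab⁻¹ * (gb * (Ab * u * Ab⁻¹) * gb⁻¹) * Ab := by group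
    _ = Ab⁻¹ * (Ab * u' * Ab⁻¹) * Ab := by rw [hconjb]
    _ = u' := by group

end Frame

/-! ## §B The integral frame read at the residue level: `J̄ = c̄ • ᵗ(σk Ā) J₀ Ā` -/

section ResidueFrame

variable {E : Type*} [Field E] [ValuativeRel E]

/-- **RESIDUE OF AN INTEGRAL FRAME**: if `J = J_𝒪` and `J = c • ᵗ(σA) J₀ A` with `A ∈ GL₃(𝒪)` and `c ∈ 𝒪`, then `J̄ = c̄ • ᵗ(σk Ā) J̄₀ Ā` for the residual frame `Ā ∈ GL₃(𝓀)` (entries = residues of `A`'s)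
and any residue action `σk` of `σ`. [cite: PlatonovRapinchuk1994, §3.3] -/
theorem exists_residueFrame_of_integralFrame (σ : E →+* E) (σk : 𝓀[E] →+* 𝓀[E]) (hσO : ∀ x : 𝒪[E], σ x ∈ 𝒪[E])
    (hσk : ∀ x : 𝒪[E], IsLocalRing.residue 𝒪[E] ⟨σ x, hσO x⟩ = σk (IsLocalRing.residue 𝒪[E] x))
    (J : Matrix (Fin 3) (Fin 3) E) (JO : Matrix (Fin 3) (Fin 3) 𝒪[E]) (hJ : J = JO.map ((↑) : 𝒪[E] → E))
    (A : GL (Fin 3) E) (hA : A ∈ glInt 3 E) (cO : 𝒪[E]) {c : E} (hc : (cO : E) = c)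
    (hframe : J = c • formCongr σ A ((StdForm.antidiagonal 3).over E)) :
    ∃ Ab : GL (Fin 3) 𝓀[E], JO.map (IsLocalRing.residue 𝒪[E]) =
      (IsLocalRing.residue 𝒪[E] cO) • formCongr σk Ab ((StdForm.antidiagonal 3).over 𝓀[E]) := by
  classical
  have hAint : ∀ i j, (A : Matrix (Fin 3) (Fin 3) E) i j ∈ 𝒪[E] := fun i j => ((mem_glInt_iff _).1 hA).1 i j
  have hAinv : ∀ i j, (((A⁻¹ : GL (Fin 3) E)) : Matrix (Fin 3) (Fin 3) E) i j ∈ 𝒪[E] := fun i j => ((mem_glInt_iff _).1 hA).2 i j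
  let AO : Matrix (Fin 3) (Fin 3) 𝒪[E] := Matrix.of fun i j => ⟨(A : Matrix (Fin 3) (Fin 3) E) i j, hAint i j⟩
  let AI : Matrix (Fin 3) (Fin 3) 𝒪[E] := Matrix.of fun i j => ⟨(((A⁻¹ : GL (Fin 3) E)) : Matrix (Fin 3) (Fin 3) E) i j, hAinv i j⟩
  have hinjO : Function.Injective (fun M : Matrix (Fin 3) (Fin 3) 𝒪[E] => M.map ((↑) : 𝒪[E] → E)) := Matrix.map_injective Subtype.val_injective
  have hAO : (A : Matrix (Fin 3) (Fin 3) E) = AO.map ((↑) : 𝒪[E] → E) := by ext i j; rfl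
  have hAI : (((A⁻¹ : GL (Fin 3) E)) : Matrix (Fin 3) (Fin 3) E) = AI.map ((↑) : 𝒪[E] → E) := by ext i j; rfl
  have hAOI : AO * AI = 1 := by
    apply hinjO
    change (AO * AI).map ⇑(𝒪[E]).subtype = (1 : Matrix (Fin 3) (Fin 3) 𝒪[E]).map ⇑(𝒪[E]).subtype
    rw [Matrix.map_mul, Matrix.map_one (𝒪[E]).subtype (map_zero _) (map_one _)]
    change AO.map ((↑) : 𝒪[E] → E) * AI.map ((↑) : 𝒪[E] → E) = 1
    rw [← hAO, ← hAI, ← Units.val_mul, mul_inv_cancel, Units.val_one]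
  have hAIO : AI * AO = 1 := by
    apply hinjO
    change (AI * AO).map ⇑(𝒪[E]).subtype = (1 : Matrix (Fin 3) (Fin 3) 𝒪[E]).map ⇑(𝒪[E]).subtype
    rw [Matrix.map_mul, Matrix.map_one (𝒪[E]).subtype (map_zero _) (map_one _)]
    change AI.map ((↑) : 𝒪[E] → E) * AO.map ((↑) : 𝒪[E] → E) = 1
    rw [← hAO, ← hAI, ← Units.val_mul, inv_mul_cancel, Units.val_one]
  let Ab : GL (Fin 3) 𝓀[E] :=
    ⟨AO.map (IsLocalRing.residue 𝒪[E]), AI.map (IsLocalRing.residue 𝒪[E]),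
      by rw [← Matrix.map_mul, hAOI, Matrix.map_one _ (map_zero _) (map_one _)],
      by rw [← Matrix.map_mul, hAIO, Matrix.map_one _ (map_zero _) (map_one _)]⟩
  refine ⟨Ab, ?_⟩
  -- entrywise: both sides are residues of the same integral expression
  ext i j
  have hE : J i j = c * ∑ x, ∑ y, σ ((A : Matrix (Fin 3) (Fin 3) E) y i) * ((StdForm.antidiagonal 3).over E) y x * (A : Matrix (Fin 3) (Fin 3) E) x j := by
    rw [hframe, Matrix.smul_apply, smul_eq_mul, formCongr, Matrix.mul_apply]
    congr 1
    refine Finset.sum_congr rfl fun x _ => ?_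
    rw [Matrix.mul_apply, Finset.sum_mul]
    refine Finset.sum_congr rfl fun y _ => ?_
    rw [Matrix.transpose_apply, Matrix.map_apply]
  have hO : JO i j = cO * ∑ x, ∑ y, (⟨σ ((A : Matrix (Fin 3) (Fin 3) E) y i), hσO (AO y i)⟩ : 𝒪[E]) * ((StdForm.antidiagonal 3).over 𝒪[E]) y x * AO x j := by
    apply Subtype.ext
    have hJij : ((JO i j : 𝒪[E]) : E) = J i j := by rw [hJ, Matrix.map_apply]
    rw [hJij, hE]
    simp only [Subring.coe_mul, AddSubmonoidClass.coe_finsetSum, hc]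
    refine congrArg _ (Finset.sum_congr rfl fun x _ => Finset.sum_congr rfl fun y _ => ?_)
    have h0 : ((((StdForm.antidiagonal 3).over 𝒪[E]) y x : 𝒪[E]) : E) = ((StdForm.antidiagonal 3).over E) y x := by
      rw [← (StdForm.antidiagonal 3).over_map (𝒪[E]).subtype, Matrix.map_apply]; rfl
    rw [h0]; rfl
  have hAb : ((Ab : GL (Fin 3) 𝓀[E]) : Matrix (Fin 3) (Fin 3) 𝓀[E]) = AO.map (IsLocalRing.residue 𝒪[E]) := rfl
  rw [Matrix.map_apply, hO, Matrix.smul_apply, smul_eq_mul, map_mul, formCongr, hAb, Matrix.mul_apply]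
  congr 1
  rw [map_sum]
  refine Finset.sum_congr rfl fun x _ => ?_
  rw [map_sum, Matrix.mul_apply, Finset.sum_mul]
  refine Finset.sum_congr rfl fun y _ => ?_
  rw [map_mul, map_mul, Matrix.transpose_apply, Matrix.map_apply, Matrix.map_apply, Matrix.map_apply, ← hσk (AO y i),
    ← (StdForm.antidiagonal 3).over_map (IsLocalRing.residue 𝒪[E]), Matrix.map_apply]
  rfl

end ResidueFrame

section OrganU

set_option maxHeartbeats 800000 in
-- budget only: one statement-heavy declaration (the CM-place tokens of the END's stub); no search tactic runs long here.
/-- **(U), pairwise form: a level-1 `K`-class piece takes EQUAL values at residually-unipotent `k, k′ ∈ K` of EQUAL Jordan rank** `rank(red k_w − 1) = rank(red k′_w − 1)`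
(`(red k_w − 1)³ = 0`, `(red k′_w − 1)³ = 0`): Hensel surjectivity `K ↠ U(σ̄_w, H̄′_w)(𝓀_w)` (★ `unitary_residueHom_surjective_of_frobenius`) lifts the finite-group
conjugator of ★ `exists_conj_eq_of_rank_sub_one_eq_of_hermitian` to `y ∈ K`; then `k′ = u·(yky⁻¹)` with `u_w ≡ 1 (ϖ)` and `g k′ = g (yky⁻¹) = g k`.
[cite: Rogawski1990, §4.9 p. 54; §3.9 p. 32, Prop. 3.9.1] [cite: PlatonovRapinchuk1994, §3.3] -/
theorem apply_eq_apply_of_rank_redMat_sub_one_eq_ramified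
    (L : Type) [Field L] [NumberField L] [IsCMField L] (H' : Matrix (Fin 3) (Fin 3) L)
    {v : HeightOneSpectrum (𝓞 ↥(maximalRealSubfield L))}
    (hH' : (H'.map (cmConjRingHom L)).transpose = H') (w : PlacesOver L v)
    (hw : IsCMField.complexConj L • w.1 = w.1) (he : v.asIdeal.ramificationIdx' w.1.asIdeal ≠ 1)
    (hH'w : IsUnit (placeForm H' w.1)) (hH'i : hH'w.unit ∈ glInt 3 (w.1.adicCompletion L))
    (h2 : IsUnit (2 : 𝒪[(w.1.adicCompletion L)]))
    -- the tame-ramified block and the SPAN-0-ram integral antidiagonal frame of `H′_w` (fold v2 binders; ★ `ramifiedBlock_adicCompletion`, ★ p846344)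
    (ϖ : (w.1.adicCompletion L)) (hϖ : Valued.v ϖ = WithZero.exp (-1 : ℤ))
    (A : GL (Fin 3) (w.1.adicCompletion L)) (hA : A ∈ glInt 3 (w.1.adicCompletion L))
    (hframe : placeForm H' w.1 = (-(placeForm H' w.1).det) • formCongr (galAdicCompletionMap (L := L) (IsCMField.complexConj L) hw) A ((StdForm.antidiagonal 3).over (w.1.adicCompletion L)))
    (g : ((cmDatum L 3 H').Local v) → ℂ)
    (hginv : ∀ u ∈ (cmLocalIntegralLevel L 3 H' v), ∀ x, g (u * x * u⁻¹) = g x)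
    (hg1 : ∀ u : ((cmDatum L 3 H').Local v),
      (∀ a b, Valued.v (ϖ⁻¹ *
        (((((localNonsplitEquiv (IsCMField.complexConj L) H' (IsCMField.complexConj_ne_one L) w hw u) : ↥(unitaryGroupOfForm (galAdicCompletionMap (L := L) (IsCMField.complexConj L) hw) (placeForm H' w.1))) : GL (Fin 3) (w.1.adicCompletion L)) : Matrix (Fin 3) (Fin 3) (w.1.adicCompletion L)) a b - (1 : Matrix (Fin 3) (Fin 3) (w.1.adicCompletion L)) a b)) ≤ 1) →
      ∀ x, g (u * x) = g x)
    {k k' : ((cmDatum L 3 H').Local v)} (hk : k ∈ (cmLocalIntegralLevel L 3 H' v)) (hk' : k' ∈ (cmLocalIntegralLevel L 3 H' v))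
    (hnil : (redMat (((k).val : GL (Fin 3) (UnitaryGroup.LocalRing L v)).val.map (Pi.evalRingHom (fun w' : PlacesOver L v => w'.1.adicCompletion L) w)) - 1) ^ 3 = 0) (hnil' : (redMat (((k').val : GL (Fin 3) (UnitaryGroup.LocalRing L v)).val.map (Pi.evalRingHom (fun w' : PlacesOver L v => w'.1.adicCompletion L) w)) - 1) ^ 3 = 0)
    (hrank : (redMat (((k).val : GL (Fin 3) (UnitaryGroup.LocalRing L v)).val.map (Pi.evalRingHom (fun w' : PlacesOver L v => w'.1.adicCompletion L) w)) - 1).rank = (redMat (((k').val : GL (Fin 3) (UnitaryGroup.LocalRing L v)).val.map (Pi.evalRingHom (fun w' : PlacesOver L v => w'.1.adicCompletion L) w)) - 1).rank) :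
    g k = g k' := by
  classical
  have hc1 : IsCMField.complexConj L ≠ 1 := IsCMField.complexConj_ne_one L
  -- §0 the place `w`: involution `σ_w`, its integral ∕ residual avatars, Frobenius, `|𝓀_w| = q²`, the `σ`-fixed uniformizer
  have hσO : ∀ x : 𝒪[(w.1.adicCompletion L)], (galAdicCompletionMap (L := L) (IsCMField.complexConj L) hw) x ∈ 𝒪[(w.1.adicCompletion L)] := mem_integer_galAdicCompletionMap (IsCMField.complexConj L) v w hw
  have hσσ : ∀ x, (galAdicCompletionMap (L := L) (IsCMField.complexConj L) hw) ((galAdicCompletionMap (L := L) (IsCMField.complexConj L) hw) x) = x := fun x => galAdicCompletionMap_galAdicCompletionMap_of_smul_eq (IsCMField.complexConj L) w hc1 hw x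
  obtain ⟨σk, hσk⟩ := exists_residueField_ringHom_galAdicCompletionMap (IsCMField.complexConj L) v w hw
  have hidx : ∀ y, σk y = y := residueHom_galAdicCompletionMap_eq_self_of_ramified (IsCMField.complexConj L) v hc1 w hw he σk hσO hσk
  have hϖu : IsUniformizingElement ϖ := isUniformizingElement_of_v_eq hϖ
  have h2k : (2 : 𝓀[(w.1.adicCompletion L)]) ≠ 0 := by
    have h := h2.map (IsLocalRing.residue 𝒪[(w.1.adicCompletion L)])
    rw [map_ofNat] at h
    exact h.ne_zero
  -- §1 the form `J = H′_w` and its integral model `J_𝒪` (unimodular, `σ_w`-hermitian)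
  have hJint : ∀ i j, (placeForm H' w.1) i j ∈ 𝒪[(w.1.adicCompletion L)] := fun i j => ((mem_glInt_iff _).1 hH'i).1 i j
  have hJinv : ∀ i j, (((hH'w.unit⁻¹ : (Matrix (Fin 3) (Fin 3) (w.1.adicCompletion L))ˣ) : Matrix (Fin 3) (Fin 3) (w.1.adicCompletion L))) i j ∈ 𝒪[(w.1.adicCompletion L)] :=
    fun i j => ((mem_glInt_iff _).1 hH'i).2 i j
  let JO : Matrix (Fin 3) (Fin 3) 𝒪[(w.1.adicCompletion L)] := Matrix.of fun i j => ⟨(placeForm H' w.1) i j, hJint i j⟩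
  have hJ : (placeForm H' w.1) = JO.map ((↑) : 𝒪[(w.1.adicCompletion L)] → (w.1.adicCompletion L)) := by ext i j; rfl
  have hinjO : Function.Injective (fun M : Matrix (Fin 3) (Fin 3) 𝒪[(w.1.adicCompletion L)] => M.map ((↑) : 𝒪[(w.1.adicCompletion L)] → (w.1.adicCompletion L))) :=
    Matrix.map_injective Subtype.val_injective
  have hJOdet : IsUnit JO.det := by
    let JI : Matrix (Fin 3) (Fin 3) 𝒪[(w.1.adicCompletion L)] :=
      Matrix.of fun i j => ⟨(((hH'w.unit⁻¹ : (Matrix (Fin 3) (Fin 3) (w.1.adicCompletion L))ˣ) : Matrix (Fin 3) (Fin 3) (w.1.adicCompletion L))) i j, hJinv i j⟩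
    have hJI : (((hH'w.unit⁻¹ : (Matrix (Fin 3) (Fin 3) (w.1.adicCompletion L))ˣ) : Matrix (Fin 3) (Fin 3) (w.1.adicCompletion L))) = JI.map ((↑) : 𝒪[(w.1.adicCompletion L)] → (w.1.adicCompletion L)) := by
      ext i j; rfl
    have hmul : JO * JI = 1 := by
      apply hinjO
      change (JO * JI).map ⇑(𝒪[(w.1.adicCompletion L)]).subtype = (1 : Matrix (Fin 3) (Fin 3) 𝒪[(w.1.adicCompletion L)]).map ⇑(𝒪[(w.1.adicCompletion L)]).subtype
      rw [Matrix.map_mul, Matrix.map_one (𝒪[(w.1.adicCompletion L)]).subtype (map_zero _) (map_one _)]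
      change JO.map ((↑) : 𝒪[(w.1.adicCompletion L)] → (w.1.adicCompletion L)) * JI.map ((↑) : 𝒪[(w.1.adicCompletion L)] → (w.1.adicCompletion L)) = 1
      rw [← hJ, ← hJI]
      have hmi := hH'w.unit.mul_inv
      rw [hH'w.unit_spec] at hmi
      exact hmi
    exact Matrix.isUnit_det_of_right_inverse hmul
  have hJσ : ((placeForm H' w.1).map (galAdicCompletionMap (L := L) (IsCMField.complexConj L) hw))ᵀ = (placeForm H' w.1) := placeForm_hermitian_of_smul_eq (c := IsCMField.complexConj L) w H' hH' hw
  clear_value JO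
  -- §2 reduction `red : K_w → U(σ̄_w, J̄)(𝓀_w)` (★ D-T1u) and its SURJECTIVITY (★ Hensel)
  obtain ⟨red, hred⟩ := exists_unitary_residueHom (galAdicCompletionMap (L := L) (IsCMField.complexConj L) hw) (placeForm H' w.1) JO hJ σk hσO hσk
  have hsurj : Function.Surjective red :=
    unitary_residueHom_surjective_of_isUnit_two (galAdicCompletionMap (L := L) (IsCMField.complexConj L) hw) (placeForm H' w.1) hσσ hσO σk hσk JO hJ hJσ hJOdet h2 red hred
  -- the residual form `J̄ = J_𝒪 mod 𝓂` is `σ̄`-hermitian and non-degenerate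
  let τ : 𝒪[(w.1.adicCompletion L)] → 𝒪[(w.1.adicCompletion L)] := fun x => ⟨(galAdicCompletionMap (L := L) (IsCMField.complexConj L) hw) x, hσO x⟩
  have hJOτ : (JO.map τ)ᵀ = JO := by
    apply hinjO
    change ((JO.map τ)ᵀ).map ((↑) : 𝒪[(w.1.adicCompletion L)] → (w.1.adicCompletion L)) = JO.map ((↑) : 𝒪[(w.1.adicCompletion L)] → (w.1.adicCompletion L))
    rw [Matrix.transpose_map]
    have hmm : (JO.map τ).map ((↑) : 𝒪[(w.1.adicCompletion L)] → (w.1.adicCompletion L)) = (JO.map ((↑) : 𝒪[(w.1.adicCompletion L)] → (w.1.adicCompletion L))).map (galAdicCompletionMap (L := L) (IsCMField.complexConj L) hw) := by ext i j; rfl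
    rw [hmm, ← hJ]
    exact hJσ
  have hJk : ((JO.map (IsLocalRing.residue 𝒪[(w.1.adicCompletion L)])).map σk)ᵀ = JO.map (IsLocalRing.residue 𝒪[(w.1.adicCompletion L)]) := by
    have h := congrArg (fun M : Matrix (Fin 3) (Fin 3) 𝒪[(w.1.adicCompletion L)] => M.map (IsLocalRing.residue 𝒪[(w.1.adicCompletion L)])) hJOτ
    simp only [Matrix.transpose_map, Matrix.map_map] at h
    have hcomp : (⇑(IsLocalRing.residue 𝒪[(w.1.adicCompletion L)]) ∘ τ) = (⇑σk ∘ ⇑(IsLocalRing.residue 𝒪[(w.1.adicCompletion L)])) := funext fun x => hσk x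
    rw [hcomp, ← Matrix.map_map] at h
    exact h
  have hJkdet : (JO.map (IsLocalRing.residue 𝒪[(w.1.adicCompletion L)])).det ≠ 0 := by
    rw [← RingHom.mapMatrix_apply, ← RingHom.map_det]
    exact (hJOdet.map _).ne_zero
  -- §3 `K` inside the domain `U(J)(𝒪_w)` of `red`; the reduction read on it (entries = residues = `redMat`)
  have hKI : ∀ {x : ((cmDatum L 3 H').Local v)}, x ∈ (cmLocalIntegralLevel L 3 H' v) → (((localNonsplitEquiv (IsCMField.complexConj L) H' (IsCMField.complexConj_ne_one L) w hw x) : ↥(unitaryGroupOfForm (galAdicCompletionMap (L := L) (IsCMField.complexConj L) hw) (placeForm H' w.1))) : GL (Fin 3) (w.1.adicCompletion L)) ∈ glInt 3 (w.1.adicCompletion L) := fun {x} hx =>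
    (mem_localIntegralLevel_iff_of_smul_eq (IsCMField.complexConj L) 3 H' hc1 w hw x).1 hx
  have hredK : ∀ z : ↥((glInt 3 (w.1.adicCompletion L)).subgroupOf (unitaryGroupOfForm (galAdicCompletionMap (L := L) (IsCMField.complexConj L) hw) (placeForm H' w.1))), (((red z : ↥(unitaryGroupOfForm σk (JO.map (IsLocalRing.residue 𝒪[(w.1.adicCompletion L)])))) : GL (Fin 3) 𝓀[(w.1.adicCompletion L)]) : Matrix (Fin 3) (Fin 3) 𝓀[(w.1.adicCompletion L)]) = redMat ((((z : ↥((glInt 3 (w.1.adicCompletion L)).subgroupOf (unitaryGroupOfForm (galAdicCompletionMap (L := L) (IsCMField.complexConj L) hw) (placeForm H' w.1)))) : ↥(unitaryGroupOfForm (galAdicCompletionMap (L := L) (IsCMField.complexConj L) hw) (placeForm H' w.1))) : GL (Fin 3) (w.1.adicCompletion L)) : Matrix (Fin 3) (Fin 3) (w.1.adicCompletion L)) := by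
    intro z
    ext i j
    rw [hred]
    exact (red_coe _).symm
  -- opaque names for the images of `k, k′` (keeps every later rewrite syntactic)
  obtain ⟨xk, hxk⟩ : ∃ z : ↥((glInt 3 (w.1.adicCompletion L)).subgroupOf (unitaryGroupOfForm (galAdicCompletionMap (L := L) (IsCMField.complexConj L) hw) (placeForm H' w.1))), (z : ↥(unitaryGroupOfForm (galAdicCompletionMap (L := L) (IsCMField.complexConj L) hw) (placeForm H' w.1))) = (localNonsplitEquiv (IsCMField.complexConj L) H' (IsCMField.complexConj_ne_one L) w hw k) := ⟨⟨(localNonsplitEquiv (IsCMField.complexConj L) H' (IsCMField.complexConj_ne_one L) w hw k), hKI hk⟩, rfl⟩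
  obtain ⟨xk', hxk'⟩ : ∃ z : ↥((glInt 3 (w.1.adicCompletion L)).subgroupOf (unitaryGroupOfForm (galAdicCompletionMap (L := L) (IsCMField.complexConj L) hw) (placeForm H' w.1))), (z : ↥(unitaryGroupOfForm (galAdicCompletionMap (L := L) (IsCMField.complexConj L) hw) (placeForm H' w.1))) = (localNonsplitEquiv (IsCMField.complexConj L) H' (IsCMField.complexConj_ne_one L) w hw k') := ⟨⟨(localNonsplitEquiv (IsCMField.complexConj L) H' (IsCMField.complexConj_ne_one L) w hw k'), hKI hk'⟩, rfl⟩
  -- the stub's spelling of `k_w` IS the one-place model's matrix (★ `coe_localNonsplitEquiv_apply`, definitional)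
  have hMk : redMat ((((xk : ↥((glInt 3 (w.1.adicCompletion L)).subgroupOf (unitaryGroupOfForm (galAdicCompletionMap (L := L) (IsCMField.complexConj L) hw) (placeForm H' w.1)))) : ↥(unitaryGroupOfForm (galAdicCompletionMap (L := L) (IsCMField.complexConj L) hw) (placeForm H' w.1))) : GL (Fin 3) (w.1.adicCompletion L)) : Matrix (Fin 3) (Fin 3) (w.1.adicCompletion L)) = redMat (((k).val : GL (Fin 3) (UnitaryGroup.LocalRing L v)).val.map (Pi.evalRingHom (fun w' : PlacesOver L v => w'.1.adicCompletion L) w)) := by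
    rw [hxk]
    exact congrArg redMat (coe_localNonsplitEquiv_apply L H' v w hw k)
  have hMk' : redMat ((((xk' : ↥((glInt 3 (w.1.adicCompletion L)).subgroupOf (unitaryGroupOfForm (galAdicCompletionMap (L := L) (IsCMField.complexConj L) hw) (placeForm H' w.1)))) : ↥(unitaryGroupOfForm (galAdicCompletionMap (L := L) (IsCMField.complexConj L) hw) (placeForm H' w.1))) : GL (Fin 3) (w.1.adicCompletion L)) : Matrix (Fin 3) (Fin 3) (w.1.adicCompletion L)) = redMat (((k').val : GL (Fin 3) (UnitaryGroup.LocalRing L v)).val.map (Pi.evalRingHom (fun w' : PlacesOver L v => w'.1.adicCompletion L) w)) := by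
    rw [hxk']
    exact congrArg redMat (coe_localNonsplitEquiv_apply L H' v w hw k')
  -- §4 the two residual unipotents and their finite-group conjugator (★ A-70 finite half)
  have hu : ((red xk : ↥(unitaryGroupOfForm σk (JO.map (IsLocalRing.residue 𝒪[(w.1.adicCompletion L)])))) : GL (Fin 3) 𝓀[(w.1.adicCompletion L)]) ∈ (unitaryGroupOfForm σk (JO.map (IsLocalRing.residue 𝒪[(w.1.adicCompletion L)]))) := (red xk).2
  have hu' : ((red xk' : ↥(unitaryGroupOfForm σk (JO.map (IsLocalRing.residue 𝒪[(w.1.adicCompletion L)])))) : GL (Fin 3) 𝓀[(w.1.adicCompletion L)]) ∈ (unitaryGroupOfForm σk (JO.map (IsLocalRing.residue 𝒪[(w.1.adicCompletion L)]))) := (red xk').2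
  have hnilk : IsNilpotent ((((red xk : ↥(unitaryGroupOfForm σk (JO.map (IsLocalRing.residue 𝒪[(w.1.adicCompletion L)])))) : GL (Fin 3) 𝓀[(w.1.adicCompletion L)]) : Matrix (Fin 3) (Fin 3) 𝓀[(w.1.adicCompletion L)]) - 1) := ⟨3, by rw [hredK, hMk]; exact hnil⟩
  have hnilk' : IsNilpotent ((((red xk' : ↥(unitaryGroupOfForm σk (JO.map (IsLocalRing.residue 𝒪[(w.1.adicCompletion L)])))) : GL (Fin 3) 𝓀[(w.1.adicCompletion L)]) : Matrix (Fin 3) (Fin 3) 𝓀[(w.1.adicCompletion L)]) - 1) := ⟨3, by rw [hredK, hMk']; exact hnil'⟩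
  have hrankk : ((((red xk : ↥(unitaryGroupOfForm σk (JO.map (IsLocalRing.residue 𝒪[(w.1.adicCompletion L)])))) : GL (Fin 3) 𝓀[(w.1.adicCompletion L)]) : Matrix (Fin 3) (Fin 3) 𝓀[(w.1.adicCompletion L)]) - 1).rank = ((((red xk' : ↥(unitaryGroupOfForm σk (JO.map (IsLocalRing.residue 𝒪[(w.1.adicCompletion L)])))) : GL (Fin 3) 𝓀[(w.1.adicCompletion L)]) : Matrix (Fin 3) (Fin 3) 𝓀[(w.1.adicCompletion L)]) - 1).rank := by
    rw [hredK, hredK, hMk, hMk']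
    exact hrank
  -- §4′ THE O₃ FRAME AT THE RESIDUE LEVEL (tame-ramified: `σ̄_w = id`) and the finite half in `O(J₀)(𝓀_w)` (★ p846826) transported through `Ā`
  have hdetJ : ((-JO.det : 𝒪[(w.1.adicCompletion L)]) : (w.1.adicCompletion L)) = -(placeForm H' w.1).det := by
    rw [hJ]
    change (𝒪[(w.1.adicCompletion L)]).subtype (-JO.det) = -((𝒪[(w.1.adicCompletion L)]).subtype.mapMatrix JO).det
    rw [map_neg, ← RingHom.map_det]
  obtain ⟨Ab, hframek⟩ := exists_residueFrame_of_integralFrame (galAdicCompletionMap (L := L) (IsCMField.complexConj L) hw) σk hσO hσk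
    (placeForm H' w.1) JO hJ A hA (-JO.det) hdetJ hframe
  have hcres : IsLocalRing.residue 𝒪[(w.1.adicCompletion L)] (-JO.det) ≠ 0 := by
    rw [map_neg, neg_ne_zero]; exact (hJOdet.map _).ne_zero
  obtain ⟨yb, hyb, hconj⟩ := exists_conj_eq_of_rank_sub_one_eq_of_residueFrame h2k hidx Ab hcres hframek hu hu' hnilk hnilk' hrankk
  -- §5 lift the conjugator (Hensel surjectivity) and conjugate inside `K`
  obtain ⟨xy, hxy⟩ := hsurj ⟨yb, hyb⟩
  obtain ⟨y, hydef⟩ : ∃ y : ((cmDatum L 3 H').Local v), y = (localNonsplitEquiv (IsCMField.complexConj L) H' (IsCMField.complexConj_ne_one L) w hw).symm (xy : ↥(unitaryGroupOfForm (galAdicCompletionMap (L := L) (IsCMField.complexConj L) hw) (placeForm H' w.1))) := ⟨_, rfl⟩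
  have hey : (localNonsplitEquiv (IsCMField.complexConj L) H' (IsCMField.complexConj_ne_one L) w hw y) = (xy : ↥(unitaryGroupOfForm (galAdicCompletionMap (L := L) (IsCMField.complexConj L) hw) (placeForm H' w.1))) := by
    rw [hydef]
    exact (localNonsplitEquiv (IsCMField.complexConj L) H' (IsCMField.complexConj_ne_one L) w hw).apply_symm_apply _
  have hy : y ∈ (cmLocalIntegralLevel L 3 H' v) := by
    refine (mem_localIntegralLevel_iff_of_smul_eq (IsCMField.complexConj L) 3 H' hc1 w hw y).2 ?_
    rw [hey]
    exact xy.2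
  obtain ⟨u, hudef⟩ : ∃ u : ((cmDatum L 3 H').Local v), u = k' * (y * k * y⁻¹)⁻¹ := ⟨_, rfl⟩
  have hyky : y * k * y⁻¹ ∈ (cmLocalIntegralLevel L 3 H' v) := Subgroup.mul_mem _ (Subgroup.mul_mem _ hy hk) (Subgroup.inv_mem _ hy)
  have humem : u ∈ (cmLocalIntegralLevel L 3 H' v) := by
    rw [hudef]
    exact Subgroup.mul_mem _ hk' (Subgroup.inv_mem _ hyky)
  obtain ⟨xu, hxu0⟩ : ∃ z : ↥((glInt 3 (w.1.adicCompletion L)).subgroupOf (unitaryGroupOfForm (galAdicCompletionMap (L := L) (IsCMField.complexConj L) hw) (placeForm H' w.1))), (z : ↥(unitaryGroupOfForm (galAdicCompletionMap (L := L) (IsCMField.complexConj L) hw) (placeForm H' w.1))) = (localNonsplitEquiv (IsCMField.complexConj L) H' (IsCMField.complexConj_ne_one L) w hw u) := ⟨⟨(localNonsplitEquiv (IsCMField.complexConj L) H' (IsCMField.complexConj_ne_one L) w hw u), hKI humem⟩, rfl⟩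
  -- push `e` through the products (by `exact`: the carrier `(cmDatum L 3 H′).Local v` is the subgroup `«local»` definitionally)
  have he1 : (localNonsplitEquiv (IsCMField.complexConj L) H' (IsCMField.complexConj_ne_one L) w hw (y * k)) = (xy : ↥(unitaryGroupOfForm (galAdicCompletionMap (L := L) (IsCMField.complexConj L) hw) (placeForm H' w.1))) * (xk : ↥(unitaryGroupOfForm (galAdicCompletionMap (L := L) (IsCMField.complexConj L) hw) (placeForm H' w.1))) := by
    rw [← hey, hxk]; exact map_mul _ y k
  have he2 : (localNonsplitEquiv (IsCMField.complexConj L) H' (IsCMField.complexConj_ne_one L) w hw (y⁻¹)) = (xy : ↥(unitaryGroupOfForm (galAdicCompletionMap (L := L) (IsCMField.complexConj L) hw) (placeForm H' w.1)))⁻¹ := by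
    rw [← hey]; exact map_inv _ y
  have he3 : (localNonsplitEquiv (IsCMField.complexConj L) H' (IsCMField.complexConj_ne_one L) w hw (y * k * y⁻¹)) = (xy : ↥(unitaryGroupOfForm (galAdicCompletionMap (L := L) (IsCMField.complexConj L) hw) (placeForm H' w.1))) * (xk : ↥(unitaryGroupOfForm (galAdicCompletionMap (L := L) (IsCMField.complexConj L) hw) (placeForm H' w.1))) * (xy : ↥(unitaryGroupOfForm (galAdicCompletionMap (L := L) (IsCMField.complexConj L) hw) (placeForm H' w.1)))⁻¹ := by
    rw [← he1, ← he2]; exact map_mul _ (y * k) y⁻¹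
  have he4 : (localNonsplitEquiv (IsCMField.complexConj L) H' (IsCMField.complexConj_ne_one L) w hw ((y * k * y⁻¹)⁻¹)) = ((xy : ↥(unitaryGroupOfForm (galAdicCompletionMap (L := L) (IsCMField.complexConj L) hw) (placeForm H' w.1))) * (xk : ↥(unitaryGroupOfForm (galAdicCompletionMap (L := L) (IsCMField.complexConj L) hw) (placeForm H' w.1))) * (xy : ↥(unitaryGroupOfForm (galAdicCompletionMap (L := L) (IsCMField.complexConj L) hw) (placeForm H' w.1)))⁻¹)⁻¹ := by
    rw [← he3]; exact map_inv _ (y * k * y⁻¹)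
  have he5 : (localNonsplitEquiv (IsCMField.complexConj L) H' (IsCMField.complexConj_ne_one L) w hw (k' * (y * k * y⁻¹)⁻¹)) = (xk' : ↥(unitaryGroupOfForm (galAdicCompletionMap (L := L) (IsCMField.complexConj L) hw) (placeForm H' w.1))) * ((xy : ↥(unitaryGroupOfForm (galAdicCompletionMap (L := L) (IsCMField.complexConj L) hw) (placeForm H' w.1))) * (xk : ↥(unitaryGroupOfForm (galAdicCompletionMap (L := L) (IsCMField.complexConj L) hw) (placeForm H' w.1))) * (xy : ↥(unitaryGroupOfForm (galAdicCompletionMap (L := L) (IsCMField.complexConj L) hw) (placeForm H' w.1)))⁻¹)⁻¹ := by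
    rw [← he4, hxk']; exact map_mul _ k' (y * k * y⁻¹)⁻¹
  have hxu : xu = xk' * (xy * xk * xy⁻¹)⁻¹ := by
    apply Subtype.ext
    simp only [Subgroup.coe_mul, Subgroup.coe_inv]
    rw [hxu0, ← he5, hudef]
  -- `red(u_w) = 1`
  have hredu' : red xu = red xk' * (red xy * red xk * (red xy)⁻¹)⁻¹ := by
    rw [hxu]
    simp only [map_mul, map_inv]
  have hredu'' : red xu = red xk' * ((⟨yb, hyb⟩ : ↥(unitaryGroupOfForm σk (JO.map (IsLocalRing.residue 𝒪[(w.1.adicCompletion L)])))) * red xk * (⟨yb, hyb⟩ : ↥(unitaryGroupOfForm σk (JO.map (IsLocalRing.residue 𝒪[(w.1.adicCompletion L)]))))⁻¹)⁻¹ := by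
    simpa only [hxy] using hredu'
  have hredu : ((red xu : ↥(unitaryGroupOfForm σk (JO.map (IsLocalRing.residue 𝒪[(w.1.adicCompletion L)])))) : GL (Fin 3) 𝓀[(w.1.adicCompletion L)]) = 1 := by
    have hcoe := congrArg (fun z : ↥(unitaryGroupOfForm σk (JO.map (IsLocalRing.residue 𝒪[(w.1.adicCompletion L)]))) => (z : GL (Fin 3) 𝓀[(w.1.adicCompletion L)])) hredu''
    simp only [Subgroup.coe_mul, Subgroup.coe_inv, hconj, mul_inv_cancel] at hcoe
    exact hcoe
  have hredMat_u : redMat ((((localNonsplitEquiv (IsCMField.complexConj L) H' (IsCMField.complexConj_ne_one L) w hw u) : ↥(unitaryGroupOfForm (galAdicCompletionMap (L := L) (IsCMField.complexConj L) hw) (placeForm H' w.1))) : GL (Fin 3) (w.1.adicCompletion L)) : Matrix (Fin 3) (Fin 3) (w.1.adicCompletion L)) = 1 := by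
    rw [← hxu0, ← hredK xu, hredu, Units.val_one]
  -- §6 the ROW-0 bridge: `u_w ≡ 1 (ϖ)`, i.e. `hg1`'s hypothesis for `u`
  have hrank0 : (redMat ((((localNonsplitEquiv (IsCMField.complexConj L) H' (IsCMField.complexConj_ne_one L) w hw u) : ↥(unitaryGroupOfForm (galAdicCompletionMap (L := L) (IsCMField.complexConj L) hw) (placeForm H' w.1))) : GL (Fin 3) (w.1.adicCompletion L)) : Matrix (Fin 3) (Fin 3) (w.1.adicCompletion L)) - 1).rank = 0 := by
    rw [hredMat_u, sub_self, Matrix.rank_zero]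
  have hval := (rank_redMat_sub_one_eq_zero_iff_forall_valuation_le hϖu (hKI humem)).1 hrank0
  have hϖ0 : Valued.v ϖ ≠ 0 := by
    rw [hϖ]; exact WithZero.coe_ne_zero
  have hg1u : ∀ x, g (u * x) = g x := by
    refine hg1 u fun a b => ?_
    have hab : Valued.v (((((localNonsplitEquiv (IsCMField.complexConj L) H' (IsCMField.complexConj_ne_one L) w hw u) : ↥(unitaryGroupOfForm (galAdicCompletionMap (L := L) (IsCMField.complexConj L) hw) (placeForm H' w.1))) : GL (Fin 3) (w.1.adicCompletion L)) : Matrix (Fin 3) (Fin 3) (w.1.adicCompletion L)) a b - (1 : Matrix (Fin 3) (Fin 3) (w.1.adicCompletion L)) a b) ≤ Valued.v ϖ := by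
      rw [← Matrix.sub_apply]
      exact (v_le_iff_valuation_le _ _).2 (hval a b)
    rw [Valuation.map_mul, Valuation.map_inv]
    have key := mul_le_mul_right hab (Valued.v ϖ)⁻¹
    rwa [inv_mul_cancel₀ hϖ0] at key
  -- §7 assemble: `g k = g (y k y⁻¹) = g (u · y k y⁻¹) = g k′`
  calc g k = g (y * k * y⁻¹) := (hginv y hy k).symm
    _ = g (u * (y * k * y⁻¹)) := (hg1u _).symm
    _ = g k' := by rw [hudef]; exact congrArg g (inv_mul_cancel_right _ _)

set_option maxHeartbeats 800000 in
-- budget only: the statement carries the END stub's CM-place tokens; no search tactic runs long here.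
/-- **ORGAN (U) «STRATA CONSTANCY OF A LEVEL-1 `K`-CLASS PIECE»** = END fold v1-le1 `stub_strataConstancy_of_levelOne` (82802cfb1ff8af2c :251–:283) in the binders
its conclusion can see: a piece `g` on `U(H′)(L⁺_v)` that is `Ad K`-invariant (`K = U(H′)(𝒪_v)` hyperspecial at the non-split unramified `v ∤ 2`) and left-invariant
under the level-1 congruence set takes ONE value `c r` on each residually-unipotent Jordan stratum `rank(red k_w − 1) = r` of `K`.  `c r` is the common value of
`apply_eq_apply_of_rank_redMat_sub_one_eq` on the stratum (and `0` off the three strata). [cite: Rogawski1990, §4.9 p. 54; §3.9 p. 32, Prop. 3.9.1] -/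
theorem strataConstancy_of_levelOne_ramified
    (L : Type) [Field L] [NumberField L] [IsCMField L] (H' : Matrix (Fin 3) (Fin 3) L)
    {v : HeightOneSpectrum (𝓞 ↥(maximalRealSubfield L))}
    (hH' : (H'.map (cmConjRingHom L)).transpose = H') (w : PlacesOver L v)
    (hw : IsCMField.complexConj L • w.1 = w.1) (he : v.asIdeal.ramificationIdx' w.1.asIdeal ≠ 1)
    (hH'w : IsUnit (placeForm H' w.1)) (hH'i : hH'w.unit ∈ glInt 3 (w.1.adicCompletion L))
    (h2 : IsUnit (2 : 𝒪[(w.1.adicCompletion L)]))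
    -- the tame-ramified block and the SPAN-0-ram integral antidiagonal frame of `H′_w` (fold v2 binders; ★ `ramifiedBlock_adicCompletion`, ★ p846344)
    (ϖ : (w.1.adicCompletion L)) (hϖ : Valued.v ϖ = WithZero.exp (-1 : ℤ))
    (A : GL (Fin 3) (w.1.adicCompletion L)) (hA : A ∈ glInt 3 (w.1.adicCompletion L))
    (hframe : placeForm H' w.1 = (-(placeForm H' w.1).det) • formCongr (galAdicCompletionMap (L := L) (IsCMField.complexConj L) hw) A ((StdForm.antidiagonal 3).over (w.1.adicCompletion L)))
    (g : ((cmDatum L 3 H').Local v) → ℂ)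
    (hginv : ∀ u ∈ (cmLocalIntegralLevel L 3 H' v), ∀ x, g (u * x * u⁻¹) = g x)
    (hg1 : ∀ u : ((cmDatum L 3 H').Local v),
      (∀ a b, Valued.v (ϖ⁻¹ *
        (((((localNonsplitEquiv (IsCMField.complexConj L) H' (IsCMField.complexConj_ne_one L) w hw u) : ↥(unitaryGroupOfForm (galAdicCompletionMap (L := L) (IsCMField.complexConj L) hw) (placeForm H' w.1))) : GL (Fin 3) (w.1.adicCompletion L)) : Matrix (Fin 3) (Fin 3) (w.1.adicCompletion L)) a b - (1 : Matrix (Fin 3) (Fin 3) (w.1.adicCompletion L)) a b)) ≤ 1) →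
      ∀ x, g (u * x) = g x) :
    ∃ c : ℕ → ℂ, ∀ k ∈ (cmLocalIntegralLevel L 3 H' v),
      (redMat (((k).val : GL (Fin 3) (UnitaryGroup.LocalRing L v)).val.map (Pi.evalRingHom (fun w' : PlacesOver L v => w'.1.adicCompletion L) w)) - 1) ^ 3 = 0 →
      g k = c (redMat (((k).val : GL (Fin 3) (UnitaryGroup.LocalRing L v)).val.map (Pi.evalRingHom (fun w' : PlacesOver L v => w'.1.adicCompletion L) w)) - 1).rank := by
  classical
  refine ⟨fun r => if h : ∃ k : ((cmDatum L 3 H').Local v), k ∈ (cmLocalIntegralLevel L 3 H' v) ∧ (redMat (((k).val : GL (Fin 3) (UnitaryGroup.LocalRing L v)).val.map (Pi.evalRingHom (fun w' : PlacesOver L v => w'.1.adicCompletion L) w)) - 1) ^ 3 = 0 ∧ (redMat (((k).val : GL (Fin 3) (UnitaryGroup.LocalRing L v)).val.map (Pi.evalRingHom (fun w' : PlacesOver L v => w'.1.adicCompletion L) w)) - 1).rank = r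
    then g h.choose else 0, fun k hk hnil => ?_⟩
  have hex : ∃ k₀ : ((cmDatum L 3 H').Local v), k₀ ∈ (cmLocalIntegralLevel L 3 H' v) ∧ (redMat (((k₀).val : GL (Fin 3) (UnitaryGroup.LocalRing L v)).val.map (Pi.evalRingHom (fun w' : PlacesOver L v => w'.1.adicCompletion L) w)) - 1) ^ 3 = 0 ∧
      (redMat (((k₀).val : GL (Fin 3) (UnitaryGroup.LocalRing L v)).val.map (Pi.evalRingHom (fun w' : PlacesOver L v => w'.1.adicCompletion L) w)) - 1).rank = (redMat (((k).val : GL (Fin 3) (UnitaryGroup.LocalRing L v)).val.map (Pi.evalRingHom (fun w' : PlacesOver L v => w'.1.adicCompletion L) w)) - 1).rank := ⟨k, hk, hnil, rfl⟩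
  dsimp only
  rw [dif_pos hex]
  exact apply_eq_apply_of_rank_redMat_sub_one_eq_ramified L H' hH' w hw he hH'w hH'i h2 ϖ hϖ A hA hframe g hginv hg1 hk hex.choose_spec.1 hnil
    hex.choose_spec.2.1 hex.choose_spec.2.2.symm

end OrganU

end Literature.NumberTheory.Rogawski1990

end
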